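/-
Copyright (c) 2026 the pub-hodgecm-mathlib formalisation cell (harness21).  Prover seat hodgecm-mathlib-LH4-p09 (g5): Track A «(D-RAM) FOUR-FRAME» squad of crux H413, unit U2H (ii-H),
leaf (ρ2b′-X) — payer LH4-p14 (g4) socket (C) brick (C2) «H-SIDE CLOSED FORM», (C2-vii): the CLASS LINKS between the inert ∕ Eisenstein datum of the descent and the ONE-FIELD
class definers of the S2′ third-field package (LH4-p05 (g4): `|ρα − Θα| < 1` ∕ `|α − Θα| < 1`), 2026-09-04.
-/
import Literature.NumberTheory.Automorphic.QuadraticDatumRamificationLink   -- ★ p857779 (this seat): `root_sum_and_prod`, `one_le_max_of_mul_eq_exp_neg_one`; brings the Valued∕ValuativeRel bridge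
import HarnessLib

/-!
# Class links in ONE-FIELD letters: inside the eigen-field model `M` (involutions `ρ`, `Θ`; base `j : F →+* M`), an INERT datum of `D` is incompatible with «`Θ` residually trivial»
# and (residue degree one) with any base of smaller residue field; an EISENSTEIN datum is incompatible with «`Θρ` residually trivial» when `|j y| = |y|²` and `#𝓀_F < #𝓀_M`
# (Serre, *Local Fields* I §6, III §5; Labesse–Langlands 1979 §2; Rogawski 1990 §4.9 Lemma 4.9.3)

Topic `NumberTheory/Automorphic`; namespace `Literature.NumberTheory.Automorphic.HermitianLatticeTree` (as ★ `QuadraticDatumRamificationLink`).  THEOREMS ONLY (no definition, no instance,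
no notation, no named fact, no `sorry`); kernel lane `--supports stmt-HodgeConjecture-24833` (count-neutral).  Cell `pub/hodgecm-mathlib` (D-0151), crux H413; Track A «(D-RAM)
FOUR-FRAME», unit U2H (ii-H), leaf (ρ2b′-X) `stub_U2H_fixedPointCensus_typeTwo_unit0` (U2H ED. 15 :418), payer LH4-p14 (g4)'s socket (C″) `hLM`.  The H-side closed form ★ p857701
`hSide_closedForm_of_tube` (this seat) hands the census file an INERT or an EISENSTEIN datum `(u, w, z)` of the descent's discriminant with the matching ℕ-law; the census file's class
split is in the ONE-FIELD letters of the S2′ third-field package (LH4-p05 (g4) `exists_thirdFieldPackage_unr`, 2026-09-04T06:15:18Z): type U = `|α − ρα| = 1`; U-Unr = `|ρα − Θα| < 1`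
(Θρ residually trivial ⇔ `M ∕ K♮` unramified ⇔ the inertia field `Fix(Θρ)` unramified); U-RamK = `|α − Θα| < 1` (Θ residually trivial); RM = `M ∕ E` ramified.  THIS file links the two
splits inside `M` (`K` below), with the square-root witness `r ∈ Fix(Θρ)`, `ρ r = −r`, `r² = j D` of ★ p857834 (`r₀ = μ − μ⁻¹`, `μ = λ∕ρλ`):
* §1 ROOTS: `τ := (ju + r∕jz)∕2`, `τ′ := ju − τ` have `τ + τ′ = ju`, `ττ′ = −jw` (★ `root_sum_and_prod`), **`ρ τ = τ′`** (`ρr = −r`), **`Θ(ρ τ) = τ`** (`Θρ r = r`), hence `Θ τ = τ′`.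
* §2 **(RK∕RM-link, Θ-side) `false_of_inert_of_theta_residually_trivial`**: an INERT datum (`|u² + 4w|_F = 1` — ★ p857701's `d_K = 0` clause —, `u w` integral, `|j y| = |y|^e`)
  and «`Θ` residually trivial» `∀ x, |x| ≤ 1 → |x − Θ x| < 1` are incompatible: `τ` is integral, so `|τ − Θτ| = |τ − τ′| < 1`, but `(τ − τ′)² = j(u² + 4w)` is a unit.  (This refutes ★
  p857701's INERT branch at U-RamK, and at RM whenever the RM frame supplies Θ-residual-triviality.)
* §3 **(RM-link, residue-degree side) `false_of_inert_of_residue_approx`** — ★ p857779 (ii) with a GENERAL exponent `|j y| = |y|^e`: an inert datum is incompatible with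
  «every integer of `K` is `j c` modulo `𝓂`» (`f = 1`).
* §4 **(U-link) `false_of_eisenstein_of_thetaRho_residually_trivial`**: an EISENSTEIN datum (`|w|_F = |ϖ_F| = exp(−1)` suffices), `|j y| = |y|²`, «`Θρ` residually trivial»
  `∀ x, |x| ≤ 1 → |x − Θ(ρ x)| < 1`, `j F ⊆ Fix ρ ∩ Fix Θ ⊆ j F` and `#𝓀[F] < #𝓀[K]` (finite) are incompatible: `|τ| = |ρτ|` and `|τ·ρτ| = |jw| = exp(−2)` make `τ` a Θρ-fixed
  UNIFORMISER of `K`; `Fix(Θρ) = jF ⊕ jF·τ` (for Θρ-fixed `x`, `b := (x − ρx)∕(τ − ρτ)` and `x − bτ` are `ρ`- and `Θ`-fixed); by parity (`|ja|` even, `|jb·τ|` odd) an integral Θρ-fixed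
  element has the residue of its `jF`-part; and Θρ-residual-triviality makes EVERY residue class Θρ-fixed-represented (`(x + Θρx)∕2` if `2` is a residue unit, else `yΘρy` and the
  bijectivity of squaring on a finite field of characteristic `2`) — so `𝓀[F] → 𝓀[K]` would be onto.
So, in the census file: U-Unr (`hτα` ⇒ Θρ residually trivial) ⊢ `hdat.resolve_right` = ★ p857701's INERT law `(q+1)qⁿ`; U-RamK (Θ residually trivial) ⊢ `hdat.resolve_left` = the
EISENSTEIN law `2q^{n+1}`; RM likewise via §2∕§3 — heir LEAD T19-05 (1)'s classes.  HONEST LABEL: HC_CM is proved only modulo the 7 printed citations (2 remaining named inputs: hLiu418 =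
stmt-HodgeConjecture-24832, h413 = stmt-HodgeConjecture-24833) until rung 0 closes; (ρ2b′-X) stays OPEN; nothing printed is asserted — valuation bookkeeping in one field.

## References
* [Serre1979] J.-P. Serre, *Local Fields*, GTM 67 (1979), Ch. I §6 Prop. 17–18 (Eisenstein: a root is a uniformiser), Ch. III §5 Thm. 3 (unramified: the inertia group acts trivially
  on the residue field; residue degree), Ch. I §7 (finite residue fields, Frobenius).
* [LabesseLanglands1979] J.-P. Labesse, R. P. Langlands, *L-indistinguishability for SL(2)*, Canad. J. Math. 31 (1979), §2 pp. 7–8 (the three kinds of quadratic tori).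
* [Rogawski1990] J. D. Rogawski, *Automorphic Representations of Unitary Groups in Three Variables*, Ann. of Math. Stud. 123 (1990), §4.9 Lemma 4.9.3 p. 56 (the eigen-field `M = E·K`
  of a regular element of `U(2)` with its two involutions).
-/

set_option autoImplicit false

noncomputable section

open scoped WithZero Valued
open WithZero IsLocalRing

namespace Literature.NumberTheory.Automorphic.HermitianLatticeTree

/-! ## §1 The roots `τ, τ′` inside `K`, and the two involutions -/

section Algebra

variable {F K : Type*} [Field F] [Field K] (j : F →+* K) (ρ Θ : K →+* K)

/-- **`ρ τ = τ′`** for `τ = (ju + r∕jz)∕2`, `τ′ = ju − τ`, when `ρ` fixes `jF` and `ρ r = −r` (`2 ≠ 0`). [cite: Rogawski1990, §4.9 Lemma 4.9.3 p. 56] -/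
theorem map_root_eq_conj (hjρ : ∀ y, ρ (j y) = j y) {u z : F} {r : K} (hρr : ρ r = -r) (h2 : (2 : K) ≠ 0) :
    ρ ((j u + r / j z) / 2) = j u - (j u + r / j z) / 2 := by
  rw [map_div₀, map_add, map_div₀, hjρ, hjρ, hρr, map_ofNat]
  field_simp
  ring

/-- **`Θ (ρ τ) = τ`** when `Θρ` fixes `jF` (`ρ`, `Θ` fix it) and `Θ (ρ r) = r`. [cite: Rogawski1990, §4.9 Lemma 4.9.3 p. 56] -/
theorem map_map_root_eq (hjρ : ∀ y, ρ (j y) = j y) (hjΘ : ∀ y, Θ (j y) = j y) {u z : F} {r : K} (hΘρr : Θ (ρ r) = r) :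
    Θ (ρ ((j u + r / j z) / 2)) = (j u + r / j z) / 2 := by
  simp only [map_div₀, map_add, map_ofNat, hjρ, hjΘ, hΘρr]

end Algebra

section OneField

variable {F K : Type*} [Field F] [Field K] [Valued F ℤᵐ⁰] [Valued K ℤᵐ⁰] (j : F →+* K) (ρ Θ : K →+* K)

/-- Both roots are INTEGRAL when `|ju| ≤ 1` and `|jw| ≤ 1` (`τ + τ′ = ju`, `ττ′ = −jw`). [cite: Serre1979, Ch. I §6] -/
theorem valued_root_le_one {x y s p : K} (hxy : x + y = s) (hprod : x * y = p) (hs : Valued.v s ≤ 1) (hp : Valued.v p ≤ 1) : Valued.v x ≤ 1 := by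
  by_contra hgt
  rw [not_le] at hgt
  have hyx : Valued.v y < Valued.v x := by
    by_contra hle
    rw [not_lt] at hle
    have h1 : (1 : ℤᵐ⁰) < Valued.v x * Valued.v x := one_lt_mul'' hgt hgt
    have h2 : Valued.v x * Valued.v x ≤ Valued.v (x * y) := by rw [map_mul]; exact mul_le_mul' le_rfl hle
    rw [hprod] at h2
    exact absurd (lt_of_lt_of_le h1 h2) (not_lt.2 hp)
  have h := Valuation.map_add_eq_of_lt_left Valued.v hyx
  rw [hxy] at h
  rw [h] at hs
  exact absurd hgt (not_lt.2 hs)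

/-! ## §2 (RK∕RM-link) an INERT datum vs «Θ residually trivial» -/

/-- **AN INERT DATUM IS INCOMPATIBLE WITH «`Θ` RESIDUALLY TRIVIAL».**  `j : F →+* K` with `|j y| = |y|^e`, `ρ`, `Θ` fixing `jF`, `r ∈ K` with `ρ r = −r`, `Θ(ρ r) = r`,
`r² = jD`, `D = (u² + 4w)·z²` (`z ≠ 0`, `2 ≠ 0`), `|u|, |w| ≤ 1` and **`|u² + 4w| = 1`** (inert: unit discriminant — ★ p857701's `d_K = 0`), together with `∀ x, |x| ≤ 1 → |x − Θx| < 1`: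
contradiction — `τ` is integral, `Θ τ = ρ τ = τ′`, so `|τ − τ′| < 1`, while `(τ − τ′)² = j(u² + 4w)` is a unit. [cite: Serre1979, Ch. III §5 Thm. 3] [cite: LabesseLanglands1979, §2 p. 8] -/
theorem false_of_inert_of_theta_residually_trivial {e : ℕ} (hj : ∀ y, Valued.v (j y) = Valued.v y ^ e)
    (hjρ : ∀ y, ρ (j y) = j y) (hjΘ : ∀ y, Θ (j y) = j y) (hΘΘ : ∀ x, Θ (Θ x) = x)
    (hΘres : ∀ x : K, Valued.v x ≤ 1 → Valued.v (x - Θ x) < 1) (h2 : (2 : K) ≠ 0)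
    {D u w z : F} (hD : (u ^ 2 + 4 * w) * z ^ 2 = D) (hz : z ≠ 0) (hu : Valued.v u ≤ 1) (hw : Valued.v w ≤ 1) (hdisc : Valued.v (u ^ 2 + 4 * w) = 1)
    {r : K} (hρr : ρ r = -r) (hΘρr : Θ (ρ r) = r) (hr : r ^ 2 = j D) : False := by
  obtain ⟨hsum, hprod⟩ := root_sum_and_prod j h2 hD hz hr
  set τ : K := (j u + r / j z) / 2 with hτ
  set τ' : K := j u - (j u + r / j z) / 2 with hτ'
  have hρτ : ρ τ = τ' := map_root_eq_conj j ρ hjρ hρr h2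
  have hΘτ : Θ τ = τ' := by
    have h := map_map_root_eq j ρ Θ hjρ hjΘ (u := u) (z := z) hΘρr
    rw [← hτ, hρτ] at h
    -- `Θ τ' = τ` ⇒ `Θ τ = τ'`
    have h' := congrArg Θ h
    rw [hΘΘ] at h'
    exact h'.symm
  have hju : Valued.v (j u) ≤ 1 := by rw [hj]; exact pow_le_one₀ zero_le hu
  have hjw : Valued.v (-j w) ≤ 1 := by rw [Valuation.map_neg, hj]; exact pow_le_one₀ zero_le hw
  have hτ1 : Valued.v τ ≤ 1 := valued_root_le_one hsum hprod hju hjw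
  have hlt : Valued.v (τ - τ') < 1 := by rw [← hΘτ]; exact hΘres τ hτ1
  -- `(τ − τ′)² = j(u² + 4w)` is a unit
  have hsq : (τ - τ') ^ 2 = j (u ^ 2 + 4 * w) := by
    have e1 : (τ - τ') ^ 2 = (τ + τ') ^ 2 - 4 * (τ * τ') := by ring
    rw [e1, hsum, hprod, map_add, map_pow, map_mul, map_ofNat]; ring
  have hv : Valued.v (τ - τ') ^ 2 = 1 := by rw [← map_pow, hsq, hj, hdisc, one_pow]
  have hlt2 : Valued.v (τ - τ') ^ 2 < 1 := pow_lt_one₀ zero_le hlt two_ne_zero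
  rw [hv] at hlt2
  exact lt_irrefl _ hlt2

/-! ## §3 (RM-link) an INERT datum vs residue degree one, general exponent -/

/-- **AN INERT DATUM IS INCOMPATIBLE WITH RESIDUE DEGREE ONE, any ramification exponent** (★ p857779 (ii) with `|j y| = |y|^e`): `j : F →+* K`, the residue approximation
`∀ x, |x| ≤ 1 → ∃ c, |c| ≤ 1 ∧ |x − jc| < 1`, `r² = jD`, `D = (u² + 4w)·z²` (`z ≠ 0`, `2 ≠ 0`), `|u|, |w| ≤ 1` and the norm form `c² + ceu − e²w` anisotropic modulo `𝔭_F`: contradiction.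
[cite: Serre1979, Ch. III §5 Thm. 3] [cite: LabesseLanglands1979, §2 p. 8] -/
theorem false_of_inert_of_residue_approx {e : ℕ} (hj : ∀ y, Valued.v (j y) = Valued.v y ^ e)
    (hres : ∀ x : K, Valued.v x ≤ 1 → ∃ c : F, Valued.v c ≤ 1 ∧ Valued.v (x - j c) < 1) (h2 : (2 : K) ≠ 0)
    {D u w z : F} (hD : (u ^ 2 + 4 * w) * z ^ 2 = D) (hz : z ≠ 0) (hu : Valued.v u ≤ 1) (hw : Valued.v w ≤ 1)
    (hanis : ∀ c e' : F, Valued.v c ≤ 1 → Valued.v e' ≤ 1 → Valued.v (c ^ 2 + c * e' * u - e' ^ 2 * w) < 1 → Valued.v c < 1 ∧ Valued.v e' < 1)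
    {r : K} (hr : r ^ 2 = j D) : False := by
  obtain ⟨hsum, hprod⟩ := root_sum_and_prod j h2 hD hz hr
  set τ : K := (j u + r / j z) / 2 with hτ
  set τ' : K := j u - (j u + r / j z) / 2 with hτ'
  have hju : Valued.v (j u) ≤ 1 := by rw [hj]; exact pow_le_one₀ zero_le hu
  have hjw : Valued.v (-j w) ≤ 1 := by rw [Valuation.map_neg, hj]; exact pow_le_one₀ zero_le hw
  have hτ1 : Valued.v τ ≤ 1 := valued_root_le_one hsum hprod hju hjw
  have hτ'1 : Valued.v τ' ≤ 1 := valued_root_le_one (by rw [add_comm]; exact hsum) (by rw [mul_comm]; exact hprod) hju hjw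
  obtain ⟨c, hc1, hcτ⟩ := hres τ hτ1
  have hN : (j c - τ) * (j c - τ') = j (c ^ 2 - c * u - w) := by
    have e1 : (j c - τ) * (j c - τ') = j c ^ 2 - j c * (τ + τ') + τ * τ' := by ring
    rw [e1, hsum, hprod, map_sub, map_sub, map_pow, map_mul]; ring
  have hvN : Valued.v (j (c ^ 2 - c * u - w)) < 1 := by
    rw [← hN, map_mul]
    have h1 : Valued.v (j c - τ) < 1 := by rw [← Valuation.map_neg, neg_sub]; exact hcτ
    have h2' : Valued.v (j c - τ') ≤ 1 := by
      refine le_trans (Valuation.map_sub _ _ _) (max_le ?_ hτ'1)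
      rw [hj]; exact pow_le_one₀ zero_le hc1
    calc Valued.v (j c - τ) * Valued.v (j c - τ') ≤ Valued.v (j c - τ) * 1 := mul_le_mul' le_rfl h2'
      _ < 1 := by rw [mul_one]; exact h1
  rw [hj] at hvN
  have hvF : Valued.v (c ^ 2 - c * u - w) < 1 := by
    by_contra hge
    rw [not_lt] at hge
    exact absurd hvN (not_lt.2 (one_le_pow₀ hge))
  have h := hanis c (-1) hc1 (by rw [Valuation.map_neg, Valuation.map_one])
    (by rw [show c ^ 2 + c * (-1) * u - (-1) ^ 2 * w = c ^ 2 - c * u - w by ring]; exact hvF)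
  rw [Valuation.map_neg, Valuation.map_one] at h
  exact lt_irrefl _ h.2

/-! ## §4 (U-link) an EISENSTEIN datum vs «Θρ residually trivial» with `|j y| = |y|²` and `#𝓀[F] < #𝓀[K]` -/

/-- Two integers of `K` congruent modulo `𝓂` have the same residue: `|x − y| < 1 ⇒ x̄ = ȳ`. [cite: Serre1979, Ch. I §7] -/
theorem residue_eq_residue_of_valued_sub_lt_one (x y : 𝒪[K]) (h : Valued.v ((x : K) - y) < 1) :
    residue 𝒪[K] x = residue 𝒪[K] y := by
  rw [← sub_eq_zero, ← map_sub, residue_eq_zero_iff, mem_maximalIdeal, mem_nonunits_iff, Valuation.Integer.not_isUnit_iff_valuation_lt_one]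
  exact h

/-- **«Θρ RESIDUALLY TRIVIAL» ⇒ EVERY RESIDUE CLASS HAS A `Θρ`-FIXED REPRESENTATIVE** (`Θρ` an involution: `ρρ = ΘΘ = id`, `Θρ = ρΘ`; finite residue field): `(x + Θρx)∕2` if `|2| = 1`,
else (residue characteristic `2`, squaring onto) `y·Θρy` with `ȳ² = x̄`. [cite: Serre1979, Ch. I §7; Ch. III §5] -/
theorem exists_fixed_residue_eq [Finite 𝓀[K]] (hρρ : ∀ x, ρ (ρ x) = x) (hΘΘ : ∀ x, Θ (Θ x) = x) (hΘρ : ∀ x, Θ (ρ x) = ρ (Θ x))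
    (hvρ : ∀ x, Valued.v (ρ x) = Valued.v x) (hvΘ : ∀ x, Valued.v (Θ x) = Valued.v x)
    (hres : ∀ x : K, Valued.v x ≤ 1 → Valued.v (x - Θ (ρ x)) < 1) (x : 𝒪[K]) :
    ∃ n : 𝒪[K], Θ (ρ (n : K)) = n ∧ residue 𝒪[K] n = residue 𝒪[K] x := by
  have hinv : ∀ y : K, Θ (ρ (Θ (ρ y))) = y := fun y => by rw [hΘρ (Θ (ρ y)), hΘΘ, hρρ]
  have h2O : (2 : K) ∈ 𝒪[K] := by simp
  have hx1 : Valued.v (x : K) ≤ 1 := (Valuation.mem_integer_iff _ _).1 x.2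
  by_cases h2 : Valued.v (2 : K) < 1
  · -- residue characteristic 2: squaring is onto on the finite field `𝓀[K]`
    have h2k : (2 : 𝓀[K]) = 0 := by
      have : residue 𝒪[K] ⟨2, h2O⟩ = 0 := by
        rw [residue_eq_zero_iff, mem_maximalIdeal, mem_nonunits_iff, Valuation.Integer.not_isUnit_iff_valuation_lt_one]; exact h2
      rw [← this, ← map_ofNat (residue 𝒪[K]) 2]; congr 1
    have hinj : Function.Injective (fun c : 𝓀[K] => c ^ 2) := by
      intro c c' hcc
      simp only at hcc
      have h0 : (c - c') ^ 2 = 0 := by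
        have : (c - c') ^ 2 = c ^ 2 + c' ^ 2 - 2 * (c * c') := by ring
        rw [this, h2k, zero_mul, sub_zero, hcc, ← two_mul, h2k, zero_mul]
      exact sub_eq_zero.1 (pow_eq_zero_iff two_ne_zero |>.1 h0)
    obtain ⟨cbar, hcbar⟩ := Finite.surjective_of_injective hinj (residue 𝒪[K] x)
    obtain ⟨y, rfl⟩ := residue_surjective cbar
    simp only at hcbar
    have hy1 : Valued.v (y : K) ≤ 1 := (Valuation.mem_integer_iff _ _).1 y.2
    have hΘρy1 : Valued.v (Θ (ρ (y : K))) ≤ 1 := by rw [hvΘ, hvρ]; exact hy1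
    have hnO : (y : K) * Θ (ρ (y : K)) ∈ 𝒪[K] := Subring.mul_mem _ y.2 ((Valuation.mem_integer_iff _ _).2 hΘρy1)
    refine ⟨⟨(y : K) * Θ (ρ (y : K)), hnO⟩, ?_, ?_⟩
    · change Θ (ρ ((y : K) * Θ (ρ (y : K)))) = (y : K) * Θ (ρ (y : K))
      rw [map_mul, map_mul, hinv, mul_comm]
    · -- residue (y·Θρy) = ȳ·ȳ = x̄
      have hrep : residue 𝒪[K] ⟨Θ (ρ (y : K)), (Valuation.mem_integer_iff _ _).2 hΘρy1⟩ = residue 𝒪[K] y :=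
        (residue_eq_residue_of_valued_sub_lt_one y _ (hres (y : K) hy1)).symm
      rw [← hcbar, pow_two, ← map_mul]
      have : (⟨(y : K) * Θ (ρ (y : K)), hnO⟩ : 𝒪[K]) = y * ⟨Θ (ρ (y : K)), (Valuation.mem_integer_iff _ _).2 hΘρy1⟩ := Subtype.ext rfl
      rw [this, map_mul, hrep, ← map_mul]
  · -- `|2| = 1`: average with the conjugate
    rw [not_lt] at h2
    have h2v : Valued.v (2 : K) = 1 := le_antisymm ((Valuation.mem_integer_iff _ _).1 h2O) h2
    have h20 : (2 : K) ≠ 0 := fun h => by rw [h, map_zero] at h2v; exact zero_ne_one h2v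
    have hΘρx1 : Valued.v (Θ (ρ (x : K))) ≤ 1 := by rw [hvΘ, hvρ]; exact hx1
    have hnO : ((x : K) + Θ (ρ (x : K))) / 2 ∈ 𝒪[K] := by
      rw [Valuation.mem_integer_iff, map_div₀, h2v, div_one]
      exact le_trans (Valuation.map_add _ _ _) (max_le hx1 hΘρx1)
    refine ⟨⟨((x : K) + Θ (ρ (x : K))) / 2, hnO⟩, ?_, ?_⟩
    · change Θ (ρ (((x : K) + Θ (ρ (x : K))) / 2)) = ((x : K) + Θ (ρ (x : K))) / 2
      rw [map_div₀, map_div₀, map_add, map_add, hinv, map_ofNat, map_ofNat, add_comm]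
    · refine residue_eq_residue_of_valued_sub_lt_one _ _ ?_
      change Valued.v (((x : K) + Θ (ρ (x : K))) / 2 - (x : K)) < 1
      have : ((x : K) + Θ (ρ (x : K))) / 2 - (x : K) = -((x : K) - Θ (ρ (x : K))) / 2 := by field_simp; ring
      rw [this, map_div₀, h2v, div_one, Valuation.map_neg]
      exact hres (x : K) hx1

/-- `|j b·τ|` is never `1` when `|j y| = |y|²` and `|τ| = exp(−1)` (an odd power of `exp`), and `|ja| ≠ |jb·τ|` unless `a = 0` or `b = 0` (parity). [cite: Serre1979, Ch. I §6] -/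
theorem valued_mul_root_ne (hj : ∀ y, Valued.v (j y) = Valued.v y ^ 2) {τ : K} (hτ : Valued.v τ = exp (-1 : ℤ)) (a b : F) (hb : b ≠ 0) :
    Valued.v (j b * τ) ≠ 1 ∧ (a ≠ 0 → Valued.v (j a) ≠ Valued.v (j b * τ)) := by
  have hvb : Valued.v b ≠ 0 := (Valuation.ne_zero_iff _).2 hb
  have hjbτ : Valued.v (j b * τ) = exp (2 * log (Valued.v b) + (-1)) := by
    rw [map_mul, hj, hτ, ← exp_log hvb, ← exp_nsmul, ← exp_add]; norm_num
  refine ⟨?_, fun ha => ?_⟩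
  · rw [hjbτ, ← exp_zero, Ne, exp_inj]; omega
  · have hva : Valued.v a ≠ 0 := (Valuation.ne_zero_iff _).2 ha
    rw [hjbτ, hj, ← exp_log hva, ← exp_nsmul, Ne, exp_inj]; norm_num; omega

/-- **AN EISENSTEIN DATUM IS INCOMPATIBLE WITH «`Θρ` RESIDUALLY TRIVIAL» WHEN `|j y| = |y|²` AND `#𝓀[F] < #𝓀[K]`** (the U-link; see the module docstring).  Hypotheses: `ρρ = ΘΘ = id`,
`Θρ = ρΘ`, both isometric; `jF` doubly fixed and `Fix ρ ∩ Fix Θ ⊆ jF`; `|j y| = |y|²`; «Θρ residually trivial» `∀ x, |x| ≤ 1 → |x − Θ(ρx)| < 1`; finite residue fields with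
`Nat.card 𝓀[F] < Nat.card 𝓀[K]`; the datum `D = (u² + 4w)z²` (`D, z ≠ 0`, `2 ≠ 0`) with the EISENSTEIN value `|w| = exp(−1)` (the clause `|u| < 1` is not even needed); the
witness `r` (`ρr = −r`, `Θ(ρr) = r`, `r² = jD`).
[cite: Serre1979, Ch. I §6 Prop. 17–18; Ch. III §5 Thm. 3] [cite: LabesseLanglands1979, §2 p. 8] [cite: Rogawski1990, §4.9 Lemma 4.9.3 p. 56] -/
theorem false_of_eisenstein_of_thetaRho_residually_trivial [Finite 𝓀[F]] [Finite 𝓀[K]]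
    (hρρ : ∀ x, ρ (ρ x) = x) (hΘΘ : ∀ x, Θ (Θ x) = x) (hΘρ : ∀ x, Θ (ρ x) = ρ (Θ x))
    (hvρ : ∀ x, Valued.v (ρ x) = Valued.v x) (hvΘ : ∀ x, Valued.v (Θ x) = Valued.v x)
    (hj : ∀ y, Valued.v (j y) = Valued.v y ^ 2) (hjρ : ∀ y, ρ (j y) = j y) (hjΘ : ∀ y, Θ (j y) = j y)
    (hfix2 : ∀ x : K, ρ x = x → Θ x = x → ∃ y : F, j y = x)
    (hres : ∀ x : K, Valued.v x ≤ 1 → Valued.v (x - Θ (ρ x)) < 1) (hcard : Nat.card 𝓀[F] < Nat.card 𝓀[K]) (h2 : (2 : K) ≠ 0)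
    {D u w z : F} (hD : (u ^ 2 + 4 * w) * z ^ 2 = D) (hD0 : D ≠ 0) (hz : z ≠ 0) (hw : Valued.v w = exp (-1 : ℤ))
    {r : K} (hρr : ρ r = -r) (hΘρr : Θ (ρ r) = r) (hr : r ^ 2 = j D) : False := by
  obtain ⟨hsum, hprod⟩ := root_sum_and_prod j h2 hD hz hr
  set τ : K := (j u + r / j z) / 2 with hτ
  set τ' : K := j u - (j u + r / j z) / 2 with hτ'
  have hρτ : ρ τ = τ' := map_root_eq_conj j ρ hjρ hρr h2
  have hΘρτ : Θ (ρ τ) = τ := map_map_root_eq j ρ Θ hjρ hjΘ hΘρr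
  -- `τ` is a uniformiser of `K` (only `|w| = exp(−1)` of the Eisenstein datum is used: `|τ| = |ρτ| = |τ′|`, `|ττ′| = |jw|`)
  have hτv : Valued.v τ = exp (-1 : ℤ) := by
    have hsq : Valued.v τ * Valued.v τ = exp (-2 : ℤ) := by
      have h1 : Valued.v τ * Valued.v τ' = exp (-2 : ℤ) := by
        rw [← map_mul, hprod, Valuation.map_neg, hj, hw, ← exp_nsmul]; norm_num
      have h1' : Valued.v τ' = Valued.v τ := by rw [← hρτ, hvρ]
      rw [h1'] at h1; exact h1
    have hτ0 : Valued.v τ ≠ 0 := fun h => by rw [h, zero_mul] at hsq; exact (exp_ne_zero hsq.symm).elim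
    rw [← exp_log hτ0, ← exp_add, exp_inj] at hsq
    rw [← exp_log hτ0]; congr 1; omega
  -- `δ := τ − ρτ ≠ 0`
  have hr0 : r ≠ 0 := by
    intro h0; rw [h0, zero_pow two_ne_zero, eq_comm, map_eq_zero] at hr; exact hD0 hr
  have hjz : j z ≠ 0 := (map_ne_zero j).2 hz
  have hδ : τ - ρ τ = r / j z := by
    rw [hρτ, hτ', hτ]; field_simp; ring
  have hδ0 : τ - ρ τ ≠ 0 := by rw [hδ]; exact div_ne_zero hr0 hjz
  -- structure of `Fix(Θρ)`: `x = ja + jb·τ`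
  have hdecomp : ∀ x : K, Θ (ρ x) = x → ∃ a b : F, x = j a + j b * τ := by
    intro x hx
    have hΘx : Θ x = ρ x := by
      have := congrArg Θ hx; rw [hΘΘ] at this; exact this.symm
    set b' : K := (x - ρ x) / (τ - ρ τ) with hb'
    have hρb' : ρ b' = b' := by
      rw [hb', map_div₀, map_sub, map_sub, hρρ, hρρ]
      rw [show (ρ x - x) / (ρ τ - τ) = (x - ρ x) / (τ - ρ τ) by rw [← neg_sub x, ← neg_sub τ, neg_div_neg_eq]]
    have hΘτ1 : Θ τ = ρ τ := by
      have := congrArg Θ hΘρτ; rw [hΘΘ] at this; exact this.symm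
    have hΘρb' : Θ (ρ b') = b' := by
      rw [hb', map_div₀, map_div₀, map_sub, map_sub, map_sub, map_sub, hρρ, hρρ, hx, hΘρτ, hΘx, hΘτ1]
    have hΘb' : Θ b' = b' := by
      have := hΘρb'; rw [hρb'] at this; exact this
    obtain ⟨b, hb⟩ := hfix2 b' hρb' hΘb'
    set a' : K := x - b' * τ with ha'
    have hρa' : ρ a' = a' := by
      rw [ha', map_sub, map_mul, hρb']
      have : x - ρ x = b' * (τ - ρ τ) := by rw [hb']; field_simp
      linear_combination -this
    have hΘρa' : Θ (ρ a') = a' := by rw [ha', map_sub, map_sub, map_mul, map_mul, hx, hΘρb', hΘρτ]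
    have hΘa' : Θ a' = a' := by
      have := hΘρa'; rw [hρa'] at this; exact this
    obtain ⟨a, ha⟩ := hfix2 a' hρa' hΘa'
    exact ⟨a, b, by rw [ha, hb, ha']; ring⟩
  -- the residue of an integral Θρ-fixed element comes from `j 𝒪[F]`
  let φ : 𝒪[F] →+* 𝒪[K] := ((j.comp 𝒪[F].subtype).codRestrict 𝒪[K]) fun y => by
    change j (y : F) ∈ 𝒪[K]
    rw [Valuation.mem_integer_iff, hj]
    exact pow_le_one₀ zero_le ((Valuation.mem_integer_iff _ _).1 y.2)
  haveI : IsLocalHom φ := ⟨fun y hy => by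
    rw [(Valuation.integer.integers (Valued.v (R := K))).isUnit_iff_valuation_eq_one] at hy
    rw [(Valuation.integer.integers (Valued.v (R := F))).isUnit_iff_valuation_eq_one]
    change Valued.v (j (y : F)) = 1 at hy
    rw [hj] at hy
    exact (pow_eq_one_iff.1 hy).resolve_right two_ne_zero⟩
  let ψ : 𝓀[F] →+* 𝓀[K] := ResidueField.map φ
  have hψ : Function.Surjective ψ := by
    intro κ
    obtain ⟨x, rfl⟩ := residue_surjective κ
    obtain ⟨n, hn, hnx⟩ := exists_fixed_residue_eq ρ Θ hρρ hΘΘ hΘρ hvρ hvΘ hres x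
    obtain ⟨a, b, hab⟩ := hdecomp (n : K) hn
    have hn1 : Valued.v (j a + j b * τ) ≤ 1 := by rw [← hab]; exact (Valuation.mem_integer_iff _ _).1 n.2
    -- parity: `|jb·τ| < 1`, `|ja| ≤ 1`
    have hsmall : Valued.v (j b * τ) < 1 ∧ Valued.v (j a) ≤ 1 := by
      rcases eq_or_ne b 0 with hb0 | hb0
      · rw [hb0, map_zero, zero_mul, map_zero]; refine ⟨zero_lt_one, ?_⟩
        rw [hb0, map_zero, zero_mul, add_zero] at hn1; exact hn1
      obtain ⟨hne1, hne⟩ := valued_mul_root_ne j hj hτv a b hb0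
      rcases eq_or_ne a 0 with ha0 | ha0
      · rw [ha0, map_zero, zero_add] at hn1
        rw [ha0, map_zero, Valuation.map_zero]
        exact ⟨lt_of_le_of_ne hn1 hne1, zero_le⟩
      · have hmax := Valuation.map_add_of_distinct_val Valued.v (hne ha0)
        rw [hmax, max_le_iff] at hn1
        exact ⟨lt_of_le_of_ne hn1.2 hne1, hn1.1⟩
    have ha1 : a ∈ 𝒪[F] := by
      rw [Valuation.mem_integer_iff]
      have := hsmall.2; rw [hj] at this
      exact (pow_le_one_iff_of_nonneg zero_le two_ne_zero).1 this
    refine ⟨residue 𝒪[F] ⟨a, ha1⟩, ?_⟩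
    rw [ResidueField.map_residue, ← hnx]
    refine residue_eq_residue_of_valued_sub_lt_one _ _ ?_
    change Valued.v (j a - (n : K)) < 1
    rw [hab, show j a - (j a + j b * τ) = -(j b * τ) by ring, Valuation.map_neg]
    exact hsmall.1
  have hle := Nat.card_le_card_of_surjective ψ hψ
  omega

end OneField

end Literature.NumberTheory.Automorphic.HermitianLatticeTree

end
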